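import Summits.MatrixMultiplication.MatrixMultiplication.Theorems.OutsiderSandwichTwistGluing
import HarnessLib

/-!
# The twist capacity law: `#patterns × rank ≤ 6^N` for a sign-untwisted copy

Route `OutsiderSandwich` (decomposition cell `decomp-mm`, lens 4 «minimal counterexample /
extremal reduction», gen 27), support for the aside leaf `BlockOneIsMM`
(stmt-MatrixMultiplication-27147, `⟺ θ⋆ = 0`); the cut of record `closes(LaserTangency,
LaserMergeOptimal, SummitIffLaserTangency)` is untouched.  Companion of
`OutsiderSandwichTwistGluing` (bit-string indices `Idx N`, twists, partial transposes
`τ_c = ptrans c`, the separable no-go `two_pow_le_of_sepCert`).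

## Content: the first conservation law that survives block MIXING

`two_pow_le_of_sepCert` priced only SEPARABLE certificates (one block per target column).  Every
certificate for `⟨B⟩ ⊠ C₁^{⊠N} ⊵ ⟨2^N,2^N,2^N⟩` beating rate one mixes several twisted blocks
`τ_c(A_i X)` of one copy `i` into the target columns, and the load-bearing constraint is the
SHARED `x`-leg map `A_i` of the copy (not a Schmidt rank of the single block).  This file prices
that sharing.  Call a set `C` of patterns **sign-untwisted on a subspace `E`** of `2^N × 2^N`
matrices if every `τ_c`, `c ∈ C`, acts on `E` by a scalar (`τ_c Y = ε_c Y` for `Y ∈ E`; for the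
blocks of a certificate: `τ_c ∘ A_i = ε_c A_i`, `E = range A_i`).  Then

* `card_mul_finrank_le` — **capacity law** `|C| · dim E ≤ 6^N`.  Proof: the patterns acting by
  scalars form a subgroup `U ⊇ C` of `(ℤ/2)^N`; a member of `E` is determined
  by its entries on a transversal of the `U`-orbits on index pairs (`finrank_le_card_of_vanishing`),
  so `dim E ≤ #orbits`; by Burnside (`AddAction.sum_card_fixedBy_eq_card_orbits_mul_card_addGroup`)
  `|U| · #orbits = Σ_{c ∈ U} #Fix(twist_c) ≤ Σ_{all c} #Fix(twist_c) = ∏_{i<N} (4 + 2) = 6^N`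
  (`sum_card_fixed_eq`: a twist fixes `(r, s)` iff `r_i = s_i` at every twisted position).
* `finrank_le_three_pow` — a copy all of whose `2^N` blocks are sign-untwisted has rank `≤ 3^N`;
  `finrank_eq_three_pow_of_invariants` / `capacity_attained` — the law is SHARP: the subspace of
  twist-invariant matrices (`τ_c Y = Y` for all `c`; the ranges of the copies of the symmetric
  core certificate; it exists, `exists_invariants`) has dimension exactly `3^N` (orbit indicators
  are independent; `#orbits = 3^N` again by Burnside), so `2^N · 3^N = 6^N` — the core's copies
  are capacity-saturating.
* `card_mul_finrank_range_le` — the form consumed by the column-disjoint no-go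
  (`OutsiderSandwichCoreOptimal`): for a linear `x`-leg map `A` and patterns `C` with
  `τ_c ∘ A = ε_c • A`, `|C| · rank A ≤ 6^N`.

Why this is the right currency: a target column needs `4^N` dimensions of `X` delivered through
blocks whose ranks add up (`OutsiderSandwichCoreOptimal`), `2^N` columns need `8^N`; a copy offers
`|C_i| · rank A_i ≤ 6^N` if its used blocks are sign-untwisted — hence `B ≥ (4/3)^N`, the census
value `⌈(4/3)^N⌉` of the symmetric core, and a certificate of smaller rate must use a GENUINELY
TWISTED block (`τ_c A_i ≠ ± A_i`) or share a block between columns.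

No definition, no instance, no Literature notion is introduced (the twist action of `(ℤ/2)^N` on
index pairs and the subgroup of scalar patterns are built locally inside the two Burnside proofs).

## References

* J.-P. Serre, *Linear Representations of Finite Groups*, GTM 42 (1977), §2.3, Ex. 2.6
  (Burnside's orbit-counting lemma). [Serre1977]
* M. Bläser, *Fast Matrix Multiplication*, Theory of Computing Graduate Surveys 5 (2013), §5,
  Def. 7.2 (restrictions of `⟨k,m,n⟩`). [Blaser2013]
* D. Coppersmith, S. Winograd, *Matrix multiplication via arithmetic progressions*,
  J. Symb. Comp. 9 (1990), §7 (coupled blocks). [CoppersmithWinograd1990]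
-/

noncomputable section

open scoped BigOperators Matrix

set_option linter.dupNamespace false
set_option autoImplicit false

namespace Summit.MatrixMultiplication.MatrixMultiplication.Theorems.OutsiderSandwichTwistCapacity

open Summit.MatrixMultiplication.MatrixMultiplication.Theorems.OutsiderSandwichTwistGluing

universe u

variable {N : ℕ}

/-! ## 1. Fixed points of twists: `Σ_c #Fix(twist_c) = 6^N` -/

/-- A twist fixes the pair `(r, s)` iff `r` and `s` agree at every twisted position. -/
theorem twist_eq_self_iff (c : Idx N) (p : Idx N × Idx N) :
    twist c p.1 p.2 = p ↔ ∀ i, c i = 1 → p.1 i = p.2 i := by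
  obtain ⟨r, s⟩ := p
  constructor
  · intro h i hi
    have h2 := congrFun (congrArg Prod.snd h) i
    simp only [twist_snd, if_pos hi] at h2
    exact h2
  · intro h
    refine Prod.ext (funext fun i => ?_) (funext fun i => ?_)
    · simp only [twist_fst]
      by_cases hi : c i = 1
      · rw [if_pos hi]; exact (h i hi).symm
      · rw [if_neg hi]
    · simp only [twist_snd]
      by_cases hi : c i = 1
      · rw [if_pos hi]; exact h i hi
      · rw [if_neg hi]

/-- One coordinate of a (pattern, row, column) triple fixed by its twist: `6` of the `8` bit
triples (`c = 0`: any `(r, s)`; `c = 1`: `r = s`). -/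
theorem card_fixedCoord :
    Fintype.card {t : Fin 2 × (Fin 2 × Fin 2) // t.1 = 1 → t.2.1 = t.2.2} = 6 := by
  rfl

/-- **`Σ_c #Fix(twist_c) = 6^N`**: the triples `(c, r, s)` with `twist_c (r, s) = (r, s)` are the
`N`-fold product of the `6` admissible bit triples. -/
theorem sum_card_fixed_eq :
    ∑ c : Idx N, Fintype.card {p : Idx N × Idx N // twist c p.1 p.2 = p} = 6 ^ N := by
  have e : {x : Idx N × (Idx N × Idx N) // twist x.1 x.2.1 x.2.2 = x.2} ≃
      (Fin N → {t : Fin 2 × (Fin 2 × Fin 2) // t.1 = 1 → t.2.1 = t.2.2}) :=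
    { toFun := fun x i =>
        ⟨(x.1.1 i, (x.1.2.1 i, x.1.2.2 i)), (twist_eq_self_iff x.1.1 x.1.2).1 x.2 i⟩
      invFun := fun g =>
        ⟨(fun i => (g i).1.1, (fun i => (g i).1.2.1, fun i => (g i).1.2.2)),
          (twist_eq_self_iff _ _).2 fun i => (g i).2⟩
      left_inv := fun x => rfl
      right_inv := fun g => rfl }
  calc ∑ c : Idx N, Fintype.card {p : Idx N × Idx N // twist c p.1 p.2 = p}
      = Fintype.card (Σ c : Idx N, {p : Idx N × Idx N // twist c p.1 p.2 = p}) :=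
        Fintype.card_sigma.symm
    _ = Fintype.card {x : Idx N × (Idx N × Idx N) // twist x.1 x.2.1 x.2.2 = x.2} :=
        (Fintype.card_congr (Equiv.subtypeProdEquivSigmaSubtype
          (fun (c : Idx N) (p : Idx N × Idx N) => twist c p.1 p.2 = p))).symm
    _ = Fintype.card (Fin N → {t : Fin 2 × (Fin 2 × Fin 2) // t.1 = 1 → t.2.1 = t.2.2}) :=
        Fintype.card_congr e
    _ = 6 ^ N := by rw [Fintype.card_fun, Fintype.card_fin, card_fixedCoord]

/-- `#(ℤ/2)^N = 2^N`. -/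
theorem card_Idx : Fintype.card (Idx N) = 2 ^ N := by
  rw [Fintype.card_fun, Fintype.card_fin, Fintype.card_fin]

/-! ## 2. A subspace determined on a set of entries -/

/-- If every member of a subspace `E` of matrices is determined by its entries on the finite set
`T` of positions (vanishing on `T` forces vanishing), then `dim E ≤ |T|`. -/
theorem finrank_le_card_of_vanishing {K : Type u} [Field K] {m n : Type*}
    (E : Submodule K (Matrix m n K)) (T : Finset (m × n))
    (hT : ∀ Y ∈ E, (∀ t ∈ T, Y t.1 t.2 = 0) → Y = 0) : Module.finrank K E ≤ T.card := by
  classical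
  let f : E →ₗ[K] (T → K) :=
    { toFun := fun Y t => (Y : Matrix m n K) t.1.1 t.1.2
      map_add' := fun _ _ => funext fun _ => rfl
      map_smul' := fun _ _ => funext fun _ => rfl }
  have hf : Function.Injective f := by
    rw [injective_iff_map_eq_zero]
    intro Y hY
    exact Subtype.ext (hT Y Y.2 fun t ht => congrFun hY ⟨t, ht⟩)
  calc Module.finrank K E ≤ Module.finrank K (T → K) :=
        LinearMap.finrank_le_finrank_of_injective hf
    _ = T.card := by rw [Module.finrank_fintype_fun_eq_card, Fintype.card_coe]

/-! ## 3. Linearity of partial transposes -/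

section Field

variable {K : Type u} [Field K]

/-- In `Fin 2`, `-a = a`. -/
private theorem neg_coord (a : Fin 2) : -a = a := by
  revert a; decide

/-- Partial transposes are linear: scalars. -/
theorem ptrans_smul (c : Idx N) (a : K) (Y : Matrix (Idx N) (Idx N) K) :
    ptrans c (a • Y) = a • ptrans c Y := by
  ext r s; simp only [ptrans_apply, Matrix.smul_apply]

/-- Partial transposes are linear: sums. -/
theorem ptrans_add (c : Idx N) (X Y : Matrix (Idx N) (Idx N) K) :
    ptrans c (X + Y) = ptrans c X + ptrans c Y := by
  ext r s; simp only [ptrans_apply, Matrix.add_apply]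

/-- Partial transposes are linear: zero. -/
theorem ptrans_zero_matrix (c : Idx N) : ptrans c (0 : Matrix (Idx N) (Idx N) K) = 0 := by
  ext r s; simp only [ptrans_apply, Matrix.zero_apply]

/-! ## 4. Orbit transversals (Burnside) -/

/-- **Orbit transversal.**  For a subgroup `U` of patterns containing the finite set `C` there is
a set `T` of index pairs meeting every `U`-orbit, with `|C| · |T| ≤ 6^N`
(Burnside: `|U| · #orbits = Σ_{c ∈ U} #Fix(twist_c) ≤ 6^N`). -/
theorem exists_transversal (U : AddSubgroup (Idx N)) (C : Finset (Idx N)) (hC : ∀ c ∈ C, c ∈ U) :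
    ∃ T : Finset (Idx N × Idx N),
      (∀ p : Idx N × Idx N, ∃ t ∈ T, ∃ c ∈ U, twist c t.1 t.2 = p) ∧ C.card * T.card ≤ 6 ^ N := by
  classical
  letI : AddAction (Idx N) (Idx N × Idx N) :=
    { vadd := fun c p => twist c p.1 p.2
      zero_vadd := fun p => show twist 0 p.1 p.2 = p by rw [twist_zero]
      add_vadd := fun a b p => (twist_comp b a p.1 p.2).symm }
  let S : Setoid (Idx N × Idx N) := AddAction.orbitRel U (Idx N × Idx N)
  refine ⟨Finset.univ.image (Quotient.out : Quotient S → Idx N × Idx N), fun p => ?_, ?_⟩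
  · refine ⟨(Quotient.mk S p).out, Finset.mem_image_of_mem _ (Finset.mem_univ _), ?_⟩
    -- `Quotient.mk_out p : out ∈ orbit U p`, i.e. `∃ u, u +ᵥ p = out` by unfolding
    obtain ⟨u, hu⟩ := Quotient.mk_out (s := S) p
    refine ⟨u, u.2, ?_⟩
    rw [← hu]
    exact twist_twist (u : Idx N) p.1 p.2
  · have hT : (Finset.univ.image (Quotient.out : Quotient S → Idx N × Idx N)).card =
        Fintype.card (Quotient S) :=
      (Finset.card_image_of_injective _ Quotient.out_injective).trans Finset.card_univ
    have hCU : C.card ≤ Fintype.card U := by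
      have h := Fintype.card_le_of_injective (fun x : C => (⟨x.1, hC x.1 x.2⟩ : U))
        (fun x y hxy => Subtype.ext (by simpa using congrArg (fun w : U => (w : Idx N)) hxy))
      rwa [Fintype.card_coe] at h
    have burnside := AddAction.sum_card_fixedBy_eq_card_orbits_mul_card_addGroup U (Idx N × Idx N)
    have hfix : ∀ u : U, Fintype.card (AddAction.fixedBy (Idx N × Idx N) u) =
        Fintype.card {p : Idx N × Idx N // twist (u : Idx N) p.1 p.2 = p} :=
      fun u => Fintype.card_congr (Equiv.subtypeEquivRight fun p => Iff.rfl)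
    have hsub : ∑ u : U, Fintype.card {p : Idx N × Idx N // twist (u : Idx N) p.1 p.2 = p} =
        ∑ c ∈ Finset.univ.filter (· ∈ U),
          Fintype.card {p : Idx N × Idx N // twist c p.1 p.2 = p} :=
      (Finset.sum_subtype (Finset.univ.filter (· ∈ U)) (fun c => by simp)
        (fun c => Fintype.card {p : Idx N × Idx N // twist c p.1 p.2 = p})).symm
    calc C.card * (Finset.univ.image (Quotient.out : Quotient S → Idx N × Idx N)).card
        ≤ Fintype.card U * Fintype.card (Quotient S) := by
          rw [hT]; exact Nat.mul_le_mul_right _ hCU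
      _ = ∑ u : U, Fintype.card (AddAction.fixedBy (Idx N × Idx N) u) := by
          rw [burnside, mul_comm]
      _ = ∑ c ∈ Finset.univ.filter (· ∈ U),
            Fintype.card {p : Idx N × Idx N // twist c p.1 p.2 = p} := by
          rw [Finset.sum_congr rfl fun u _ => hfix u, hsub]
      _ ≤ ∑ c : Idx N, Fintype.card {p : Idx N × Idx N // twist c p.1 p.2 = p} :=
          Finset.sum_le_sum_of_subset (Finset.filter_subset _ _)
      _ = 6 ^ N := sum_card_fixed_eq

/-! ## 5. The capacity law -/

/-- **Capacity law.**  If every pattern of the finite set `C` acts on the subspace `E` of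
`2^N × 2^N` matrices by a scalar (`τ_c Y = ε_c • Y` on `E`), then `|C| · dim E ≤ 6^N`. -/
theorem card_mul_finrank_le (E : Submodule K (Matrix (Idx N) (Idx N) K)) (C : Finset (Idx N))
    (hC : ∀ c ∈ C, ∃ ε : K, ∀ Y ∈ E, ptrans c Y = ε • Y) :
    C.card * Module.finrank K E ≤ 6 ^ N := by
  -- the scalar patterns of `E` form a subgroup of `(ℤ/2)^N` (group law of the partial transposes)
  let U : AddSubgroup (Idx N) :=
    { carrier := {c | ∃ ε : K, ∀ Y ∈ E, ptrans c Y = ε • Y}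
      zero_mem' := ⟨1, fun Y _ => by rw [ptrans_zero, one_smul]⟩
      add_mem' := by
        rintro a b ⟨ε, hε⟩ ⟨ε', hε'⟩
        refine ⟨ε * ε', fun Y hY => ?_⟩
        rw [← ptrans_comp, hε Y hY, ptrans_smul, hε' Y hY, smul_smul]
      neg_mem' := by
        intro a ha
        have h : -a = a := funext fun i => by rw [Pi.neg_apply, neg_coord]
        rw [h]; exact ha }
  obtain ⟨T, hcov, hcard⟩ := exists_transversal U C fun c hc => show c ∈ U from hC c hc
  have hE : Module.finrank K E ≤ T.card := by
    refine finrank_le_card_of_vanishing E T fun Y hY h0 => ?_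
    ext r s
    obtain ⟨t, ht, c, ⟨ε, hε⟩, htw⟩ := hcov (r, s)
    have h := congrFun (congrFun (hε Y hY) t.1) t.2
    rw [ptrans_apply, htw, Matrix.smul_apply, h0 t ht, smul_zero] at h
    exact h
  calc C.card * Module.finrank K E ≤ C.card * T.card := Nat.mul_le_mul_left _ hE
    _ ≤ 6 ^ N := hcard

/-- **Capacity law for an `x`-leg map.**  If the patterns of `C` act by scalars after the linear
map `A` (`τ_c (A X) = ε_c • A X` for all `X` — the blocks `(A, c)`, `c ∈ C`, are
SIGN-UNTWISTED), then `|C| · rank A ≤ 6^N`. -/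
theorem card_mul_finrank_range_le
    (A : Matrix (Idx N) (Idx N) K →ₗ[K] Matrix (Idx N) (Idx N) K) (C : Finset (Idx N))
    (hC : ∀ c ∈ C, ∃ ε : K, ∀ X, ptrans c (A X) = ε • A X) :
    C.card * Module.finrank K (LinearMap.range A) ≤ 6 ^ N :=
  card_mul_finrank_le _ C fun c hc => by
    obtain ⟨ε, hε⟩ := hC c hc
    refine ⟨ε, fun Y hY => ?_⟩
    obtain ⟨X, rfl⟩ := LinearMap.mem_range.1 hY
    exact hε X

/-- A subspace on which ALL `2^N` partial transposes act by scalars has dimension `≤ 3^N`. -/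
theorem finrank_le_three_pow (E : Submodule K (Matrix (Idx N) (Idx N) K))
    (h : ∀ c : Idx N, ∃ ε : K, ∀ Y ∈ E, ptrans c Y = ε • Y) :
    Module.finrank K E ≤ 3 ^ N := by
  have hle := card_mul_finrank_le E Finset.univ fun c _ => h c
  rw [Finset.card_univ, card_Idx, show (6 : ℕ) ^ N = 2 ^ N * 3 ^ N by rw [← mul_pow]; norm_num]
    at hle
  exact Nat.le_of_mul_le_mul_left hle (pow_pos two_pos N)

/-! ## 6. Sharpness: the twist-invariant matrices have dimension exactly `3^N` -/

/-- The twist-invariant matrices (`τ_c Y = Y` for every pattern `c` — the ranges of the copies of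
the symmetric core certificate) form a subspace. -/
theorem exists_invariants :
    ∃ E : Submodule K (Matrix (Idx N) (Idx N) K), ∀ Y, Y ∈ E ↔ ∀ c : Idx N, ptrans c Y = Y :=
  ⟨{ carrier := {Y | ∀ c : Idx N, ptrans c Y = Y}
     add_mem' := fun {X Y} hX hY c => by rw [ptrans_add, hX c, hY c]
     zero_mem' := fun c => ptrans_zero_matrix c
     smul_mem' := fun a Y hY c => by
       show ptrans c (a • Y) = a • Y
       rw [ptrans_smul, hY c] }, fun _ => Iff.rfl⟩

/-- **Lower bound `3^N ≤ dim`** for the twist-invariant subspace: the indicators of the `3^N`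
orbits of the full twist group on index pairs are twist-invariant and linearly independent. -/
theorem three_pow_le_finrank_of_invariants (E : Submodule K (Matrix (Idx N) (Idx N) K))
    (hE : ∀ Y, Y ∈ E ↔ ∀ c : Idx N, ptrans c Y = Y) : 3 ^ N ≤ Module.finrank K E := by
  classical
  letI : AddAction (Idx N) (Idx N × Idx N) :=
    { vadd := fun c p => twist c p.1 p.2
      zero_vadd := fun p => show twist 0 p.1 p.2 = p by rw [twist_zero]
      add_vadd := fun a b p => (twist_comp b a p.1 p.2).symm }
  let S : Setoid (Idx N × Idx N) := AddAction.orbitRel (Idx N) (Idx N × Idx N)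
  -- the number of orbits is `3^N` (Burnside with the exact fixed-point count)
  have hΩ : Fintype.card (Quotient S) = 3 ^ N := by
    have hB := AddAction.sum_card_fixedBy_eq_card_orbits_mul_card_addGroup (Idx N) (Idx N × Idx N)
    have hfix : ∀ c : Idx N, Fintype.card (AddAction.fixedBy (Idx N × Idx N) c) =
        Fintype.card {p : Idx N × Idx N // twist c p.1 p.2 = p} :=
      fun c => Fintype.card_congr (Equiv.subtypeEquivRight fun p => Iff.rfl)
    rw [Finset.sum_congr rfl fun c _ => hfix c, sum_card_fixed_eq, card_Idx,
      show (6 : ℕ) ^ N = 3 ^ N * 2 ^ N by rw [← mul_pow]; norm_num] at hB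
    exact (Nat.eq_of_mul_eq_mul_right (pow_pos two_pos N) hB).symm
  -- orbit indicators
  let ind : Quotient S → Matrix (Idx N) (Idx N) K :=
    fun ω r s => if Quotient.mk S (r, s) = ω then 1 else 0
  have hind : ∀ ω c, ptrans c (ind ω) = ind ω := by
    intro ω c
    ext r s
    have hq : Quotient.mk S (twist c r s) = Quotient.mk S (r, s) := Quotient.sound ⟨c, rfl⟩
    simp only [ptrans_apply, ind, Prod.mk.eta, hq]
  have hli : LinearIndependent K ind := by
    rw [Fintype.linearIndependent_iff]
    intro g hg ω₀
    have h := congrFun (congrFun hg ω₀.out.1) ω₀.out.2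
    simp only [Matrix.sum_apply, Matrix.smul_apply, ind, Prod.mk.eta, Quotient.out_eq,
      smul_eq_mul, mul_ite, mul_one, mul_zero, Matrix.zero_apply] at h
    rwa [Finset.sum_ite_eq Finset.univ ω₀ g, if_pos (Finset.mem_univ _)] at h
  let v : Quotient S → E := fun ω => ⟨ind ω, (hE _).2 fun c => hind ω c⟩
  have hv : LinearIndependent K v := LinearIndependent.of_comp E.subtype (by exact hli)
  calc 3 ^ N = Fintype.card (Quotient S) := hΩ.symm
    _ ≤ Module.finrank K E := hv.fintype_card_le_finrank

/-- **`dim (twist-invariants) = 3^N`.** -/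
theorem finrank_eq_three_pow_of_invariants (E : Submodule K (Matrix (Idx N) (Idx N) K))
    (hE : ∀ Y, Y ∈ E ↔ ∀ c : Idx N, ptrans c Y = Y) : Module.finrank K E = 3 ^ N :=
  le_antisymm
    (finrank_le_three_pow E fun c => ⟨1, fun Y hY => by rw [one_smul]; exact (hE Y).1 hY c⟩)
    (three_pow_le_finrank_of_invariants E hE)

/-- **The capacity law is sharp**: all `2^N` patterns are untwisted (scalar `+1`) on the
twist-invariant matrices, and `2^N · 3^N = 6^N` — the copies of the symmetric core certificate
are capacity-saturating. -/
theorem capacity_attained (E : Submodule K (Matrix (Idx N) (Idx N) K))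
    (hE : ∀ Y, Y ∈ E ↔ ∀ c : Idx N, ptrans c Y = Y) :
    (Finset.univ : Finset (Idx N)).card * Module.finrank K E = 6 ^ N := by
  rw [Finset.card_univ, card_Idx, finrank_eq_three_pow_of_invariants E hE, ← mul_pow]; norm_num

end Field

end Summit.MatrixMultiplication.MatrixMultiplication.Theorems.OutsiderSandwichTwistCapacity
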